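import Summits.ResolutionOfSingularities.ResolutionOfSingularities.Theorems.HilbertSamuelEliminationCampaignW42TertiaryGeneralStrata
import Literature.AlgebraicGeometry.Resolution.NuEliminationInDim
import Literature.AlgebraicGeometry.Resolution.BlowupSequencesAppend
import HarnessLib

/-!
# [OURS · L1 W4.2] Assembly over a field, WITH PERMISSIBILITY: `ν`-eliminations of all maximal strata of the reduced
# `k`-schemes of dimension `≤ d` ⇒ permissible resolution sequences (CJS Def. 6.14 → Def. 6.15 → Cor. 6.18 with
# Thm. 6.17), in the form the canonical sequence's ORACLE consumes (`--supports stmt-ResolutionOfSingularities-17846`)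

OURS (slot W4.2 of cell res-hironaka, LADDER-RESOLUTION rung L, D-0089; prover seat res-L1-s42-pv-2, gen 2); NOT
statements of H. Hironaka's manuscript [Hironaka2017]; nothing of the manuscript is used or asserted. AI review is
weaker than expert review. Pure PROOF file; no new definition.

The tree's `NuEliminationInDim d → SigmaMaxEliminationInDim d → ResolutionSequenceInDim d` (CJS Def. 6.14 gluing, then
Cor. 6.18 by Thm. 6.17, `Literature/…/NuEliminationInDim.lean`, `SigmaMaxEliminationInDim.lean`) is phrased for ALL
reduced excellent Noetherian schemes and forgets the permissibility of the centres. The canonical sequence `S(X, ν)`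
consumes, through its oracle (`OracleAdmissible`), resolution sequences WITH PERMISSIBLE CENTRES over the non-regular
locus and regular last stage, and the campaign's `ν`-eliminations live on schemes of finite type over a field. This
file redoes the two assembly steps in that class, carrying `AllPermissible`:

* `allPermissible_append_iff` — permissibility of the centres of a concatenation.
* `exists_centreSeq_killing_finite_overField` — sequential gluing over a finite set of maximal values (verbatim the
  tree's `exists_centreSeq_killing_finite_inDim`, in the class «separated, of finite type over `k`, reduced,
  `dim ≤ d`», with `AllPermissible`).
* `exists_sigmaMaxSeq_overField` — hence a `Σ^max`-elimination SEQUENCE with permissible centres over `X ∖ Reg X`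
  (CJS Def. 6.15) for every non-regular member of the class.
* `exists_resolutionSeq_overField` — hence, by well-founded induction along `HSStep d` (CJS Thm. 6.17, tree
  `wellFounded_hsStep`), a RESOLUTION SEQUENCE with permissible centres over `X ∖ Reg X` and regular last stage for
  every member of the class: exactly an ANSWER for the oracle.

Input of all three: `ν`-eliminations WITH PERMISSIBLE CENTRES for every member of the class and every maximal
`ν ≠ Φ^{(d)}` — which the GeneralStrata file derives from the O2-type statement and the oracle's answers one dimension
lower (this is how the induction on dimension of the next file closes up).

## References

* V. Cossart, U. Jannsen, S. Saito, LNM 2270 (2020), Def. 6.14, Def. 6.15, Thm. 6.17, Cor. 6.18, Rem. 6.29 (1).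
  [CossartJannsenSaito2020]
-/

noncomputable section

set_option linter.dupNamespace false -- mandated namespace of this single-conjunct summit

open CategoryTheory AlgebraicGeometry TopologicalSpace Topology IsLocalRing

namespace Summit.ResolutionOfSingularities.ResolutionOfSingularities.Theorems

namespace CampaignW42

open Literature.AlgebraicGeometry.Resolution Literature.RingTheory.HilbertSamuel

universe u

/-! ## Permissibility along a concatenation -/

/-- The centres of `s.append t` are permissible iff those of `s` and of `t` are. [folklore] -/
theorem allPermissible_append_iff :
    ∀ {X : Scheme.{u}} (s : CentreSeq X) (t : CentreSeq s.top),
      (s.append t).AllPermissible ↔ s.AllPermissible ∧ t.AllPermissible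
  | _, CentreSeq.nil _, t => by simp
  | _, CentreSeq.cons C rest, t => by
    rw [CentreSeq.cons_append, CentreSeq.allPermissible_cons, CentreSeq.allPermissible_cons,
      allPermissible_append_iff rest t, and_assoc]
    exact Iff.rfl

/-! ## Sequential gluing over finitely many maximal values, over a field, with permissibility -/

variable {k : Type u} [Field k] {d : ℕ}

/-- **Sequential gluing of `ν`-eliminations with permissible centres (CJS Def. 6.14), over a field.** Let the class
be: `Y` separated of finite type over `k`, reduced, `dim Y ≤ d`; assume every member has, for every maximal
`ν ≠ Φ^{(d)}`, a blow-up sequence with PERMISSIBLE centres over `Y(ν)`, `H^d` non-increasing, killing `ν`. Then for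
every member `Y` and finite set `S` of maximal values `≠ Φ^{(d)}` there is a blow-up sequence with permissible
centres over `{H ∈ S}`, `H^d` non-increasing, killing every `ν ∈ S`. [cite: CossartJannsenSaito2020, Def. 6.14] -/
theorem exists_centreSeq_killing_finite_overField
    (hν : ∀ (Y : Scheme.{u}) (g : Y ⟶ Spec (.of k)) [IsSeparated g] [LocallyOfFiniteType g] [QuasiCompact g]
      [IsReduced Y], topologicalKrullDim Y ≤ (d : WithBot ℕ∞) →
      ∀ ν : ℕ → ℕ, Maximal (· ∈ Scheme.hsValues Y d) ν → ν ≠ iterPSum d Phi →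
        ∃ s : CentreSeq Y, s.AllPermissible ∧ s.CentresOver (Scheme.hsStratum Y d ν) ∧
          (∀ y' : s.top, Scheme.hsFun s.top d y' ≤ Scheme.hsFun Y d (s.comp.base y')) ∧
          ν ∉ Scheme.hsValues s.top d)
    {Y : Scheme.{u}} (g : Y ⟶ Spec (.of k)) [IsSeparated g] [LocallyOfFiniteType g] [QuasiCompact g]
    [IsReduced Y] (hdim : topologicalKrullDim Y ≤ (d : WithBot ℕ∞)) (S : Set (ℕ → ℕ)) (hSfin : S.Finite)
    (hS : ∀ ν ∈ S, Maximal (· ∈ Scheme.hsValues Y d) ν) (hΦ : ∀ ν ∈ S, ν ≠ iterPSum d Phi) :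
    ∃ t : CentreSeq Y, t.AllPermissible ∧ t.CentresOver {y | Scheme.hsFun Y d y ∈ S} ∧
      (∀ y' : t.top, Scheme.hsFun t.top d y' ≤ Scheme.hsFun Y d (t.comp.base y')) ∧
      ∀ ν ∈ S, ν ∉ Scheme.hsValues t.top d := by
  haveI : IsLocallyNoetherian Y := LocallyOfFiniteType.isLocallyNoetherian g
  induction S, hSfin using Set.Finite.induction_on with
  | empty =>
    exact ⟨CentreSeq.nil Y, trivial, trivial, fun _ => le_rfl, fun ν hν => absurd hν (Set.notMem_empty ν)⟩
  | @insert ν₀ S _ _ ih =>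
    obtain ⟨t₁, hperm₁, hover₁, hmono₁, hkill₁⟩ :=
      ih (fun ν hν => hS ν (Set.mem_insert_of_mem ν₀ hν)) (fun ν hν => hΦ ν (Set.mem_insert_of_mem ν₀ hν))
    have hν₀ : Maximal (· ∈ Scheme.hsValues Y d) ν₀ := hS ν₀ (Set.mem_insert ν₀ S)
    have key : ∀ {μ : ℕ → ℕ}, Maximal (· ∈ Scheme.hsValues Y d) μ → ∀ y : t₁.top,
        μ ≤ Scheme.hsFun t₁.top d y →
        Scheme.hsFun t₁.top d y = μ ∧ Scheme.hsFun Y d (t₁.comp.base y) = μ := by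
      intro μ hμ y hle
      have h1 : μ ≤ Scheme.hsFun Y d (t₁.comp.base y) := hle.trans (hmono₁ y)
      have h2 : Scheme.hsFun Y d (t₁.comp.base y) ≤ μ := hμ.2 ⟨t₁.comp.base y, rfl⟩ h1
      exact ⟨le_antisymm ((hmono₁ y).trans h2) hle, le_antisymm h2 h1⟩
    have hsub : {y : Y | Scheme.hsFun Y d y ∈ S} ⊆ {y | Scheme.hsFun Y d y ∈ insert ν₀ S} :=
      fun y hy => Set.mem_insert_of_mem ν₀ hy
    by_cases hmem : ν₀ ∈ Scheme.hsValues t₁.top d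
    · have hmax : Maximal (· ∈ Scheme.hsValues t₁.top d) ν₀ := by
        refine ⟨hmem, fun μ hμ hle => ?_⟩
        obtain ⟨y, rfl⟩ := hμ
        exact (key hν₀ y hle).1.le
      haveI : IsProper t₁.comp := CentreSeq.isProper_comp t₁
      haveI : IsReduced t₁.top := SigmaMaxModifications.Sketch.isReduced_top t₁
      have hdim₁ : topologicalKrullDim t₁.top ≤ (d : WithBot ℕ∞) := CentreSeq.topologicalKrullDim_top_le t₁ hdim
      obtain ⟨t₂, hperm₂, hover₂, hmono₂, hkill₂⟩ :=
        hν t₁.top (t₁.comp ≫ g) hdim₁ ν₀ hmax (hΦ ν₀ (Set.mem_insert ν₀ S))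
      refine ⟨t₁.append t₂, (allPermissible_append_iff t₁ t₂).mpr ⟨hperm₁, hperm₂⟩, ?_,
        CentreSeq.hsFun_append_le t₁ t₂ d hmono₁ hmono₂, fun ν hν' => ?_⟩
      · rw [CentreSeq.centresOver_append_iff]
        refine ⟨CentreSeq.CentresOver.mono t₁ hsub hover₁, CentreSeq.CentresOver.mono t₂ (fun y hy => ?_) hover₂⟩
        have hy' : Scheme.hsFun t₁.top d y = ν₀ := hy
        show Scheme.hsFun Y d (t₁.comp.base y) ∈ insert ν₀ S
        rw [(key hν₀ y hy'.symm.le).2]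
        exact Set.mem_insert ν₀ S
      · rw [CentreSeq.hsValues_top_append]
        rcases Set.mem_insert_iff.mp hν' with rfl | hνS
        · exact hkill₂
        · rintro ⟨z, hz⟩
          have h1 : ν ≤ Scheme.hsFun t₁.top d (t₂.comp.base z) := hz.symm.le.trans (hmono₂ z)
          exact hkill₁ ν hνS ⟨t₂.comp.base z, (key (hS ν hν') _ h1).1⟩
    · refine ⟨t₁, hperm₁, CentreSeq.CentresOver.mono t₁ hsub hover₁, hmono₁, fun ν hν' => ?_⟩
      rcases Set.mem_insert_iff.mp hν' with rfl | hνS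
      · exact hmem
      · exact hkill₁ ν hνS

/-- **`Σ^max`-ELIMINATION SEQUENCES WITH PERMISSIBLE CENTRES (CJS Def. 6.15), over a field**: under the same hypothesis,
every NON-REGULAR member `Y` of the class carries a blow-up sequence with permissible centres over `Y ∖ Reg Y`, `H^d`
non-increasing, after which no maximal value of `Σ_Y(d)` survives (finitely many maximal values, none `Φ^{(d)}`;
`Y_max ⊆ Y ∖ Reg Y`). [cite: CossartJannsenSaito2020, Def. 6.14, Def. 6.15] -/
theorem exists_sigmaMaxSeq_overField
    (hν : ∀ (Y : Scheme.{u}) (g : Y ⟶ Spec (.of k)) [IsSeparated g] [LocallyOfFiniteType g] [QuasiCompact g]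
      [IsReduced Y], topologicalKrullDim Y ≤ (d : WithBot ℕ∞) →
      ∀ ν : ℕ → ℕ, Maximal (· ∈ Scheme.hsValues Y d) ν → ν ≠ iterPSum d Phi →
        ∃ s : CentreSeq Y, s.AllPermissible ∧ s.CentresOver (Scheme.hsStratum Y d ν) ∧
          (∀ y' : s.top, Scheme.hsFun s.top d y' ≤ Scheme.hsFun Y d (s.comp.base y')) ∧
          ν ∉ Scheme.hsValues s.top d)
    {Y : Scheme.{u}} (g : Y ⟶ Spec (.of k)) [IsSeparated g] [LocallyOfFiniteType g] [QuasiCompact g]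
    [IsReduced Y] (hdim : topologicalKrullDim Y ≤ (d : WithBot ℕ∞)) (hreg : ¬ Scheme.IsRegular Y) :
    ∃ s : CentreSeq Y, s.AllPermissible ∧ s.CentresOver (Scheme.regularLocus Y)ᶜ ∧
      (∀ y' : s.top, Scheme.hsFun s.top d y' ≤ Scheme.hsFun Y d (s.comp.base y')) ∧
      ∀ ν : ℕ → ℕ, Maximal (· ∈ Scheme.hsValues Y d) ν → ν ∉ Scheme.hsValues s.top d := by
  haveI : IsLocallyNoetherian Y := LocallyOfFiniteType.isLocallyNoetherian g
  haveI : IsNoetherian Y := Scheme.isNoetherian_of_finiteType_over_field g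
  have hexc : Scheme.IsExcellent Y := Scheme.isExcellent_of_locallyOfFiniteType Stacks07QW_field_holds g
  have hstalk : ∀ y : Y, ∃ d' : ℕ, ringKrullDim (Y.presheaf.stalk y) = d' ∧ d' ≤ d :=
    exists_ringKrullDim_stalk_eq_of_topologicalKrullDim_le (X := Y) hdim
  have hψ : ∀ y : Y, Scheme.hsPsi Y y ≤ d := Scheme.hsPsi_le_of_topologicalKrullDim_le hdim
  have hfin : (Scheme.hsValues Y d).Finite := Scheme.finite_hsValues_of_isExcellent hexc d hψ
  have hMfin : {ν | Maximal (· ∈ Scheme.hsValues Y d) ν}.Finite := hfin.subset fun ν hν => hν.1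
  have hΦ : ∀ ν : ℕ → ℕ, Maximal (· ∈ Scheme.hsValues Y d) ν → ν ≠ iterPSum d Phi := by
    intro ν hν hνΦ
    subst hνΦ
    refine hreg ((Scheme.isRegular_iff_hsValues_subset hstalk).mpr fun μ hμ => ?_)
    have h1 : iterPSum d Phi ≤ μ := Scheme.iterPSum_Phi_le_of_mem_hsValues hμ
    exact le_antisymm (hν.2 hμ h1) h1
  obtain ⟨t, hperm, hover, hmono, hkill⟩ :=
    exists_centreSeq_killing_finite_overField hν g hdim {ν | Maximal (· ∈ Scheme.hsValues Y d) ν} hMfin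
      (fun ν hν => hν) hΦ
  refine ⟨t, hperm, CentreSeq.CentresOver.mono t ?_ hover, hmono, fun ν hν => hkill ν hν⟩
  exact fun y hy => Scheme.hsMaxLocus_subset_compl_regularLocus hstalk hreg hy

/-! ## Resolution sequences by Thm. 6.17, over a field, with permissibility -/

/-- **RESOLUTION SEQUENCES WITH PERMISSIBLE CENTRES (CJS Cor. 6.18 with Thm. 6.17), over a field**: under the same
hypothesis, every member `Y` of the class carries a blow-up sequence with PERMISSIBLE centres over `Y ∖ Reg Y` and
REGULAR last stage — well-founded induction along `HSStep d` (tree `wellFounded_hsStep`, Thm. 6.17 proved in the tree),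
concatenating `Σ^max`-elimination sequences. This is exactly an ANSWER for the oracle of `S(X, ν)` (`OracleAdmissible`).
[cite: CossartJannsenSaito2020, Cor. 6.18, Thm. 6.17, Def. 6.15] -/
theorem exists_resolutionSeq_overField
    (hν : ∀ (Y : Scheme.{u}) (g : Y ⟶ Spec (.of k)) [IsSeparated g] [LocallyOfFiniteType g] [QuasiCompact g]
      [IsReduced Y], topologicalKrullDim Y ≤ (d : WithBot ℕ∞) →
      ∀ ν : ℕ → ℕ, Maximal (· ∈ Scheme.hsValues Y d) ν → ν ≠ iterPSum d Phi →
        ∃ s : CentreSeq Y, s.AllPermissible ∧ s.CentresOver (Scheme.hsStratum Y d ν) ∧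
          (∀ y' : s.top, Scheme.hsFun s.top d y' ≤ Scheme.hsFun Y d (s.comp.base y')) ∧
          ν ∉ Scheme.hsValues s.top d)
    (Y : Scheme.{u}) :
    ∀ (g : Y ⟶ Spec (.of k)) [IsSeparated g] [LocallyOfFiniteType g] [QuasiCompact g] [IsReduced Y],
      topologicalKrullDim Y ≤ (d : WithBot ℕ∞) →
      ∃ s : CentreSeq Y, s.AllPermissible ∧ s.CentresOver (Scheme.regularLocus Y)ᶜ ∧
        Literature.AlgebraicGeometry.Resolution.Scheme.IsRegular s.top := by
  induction Y using (wellFounded_hsStep.{u} d).induction with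
  | _ Y ih => ?_
  intro g _ _ _ _ hdim
  haveI : IsLocallyNoetherian Y := LocallyOfFiniteType.isLocallyNoetherian g
  haveI : IsNoetherian Y := Scheme.isNoetherian_of_finiteType_over_field g
  have hexc : Scheme.IsExcellent Y := Scheme.isExcellent_of_locallyOfFiniteType Stacks07QW_field_holds g
  by_cases hreg : Scheme.IsRegular Y
  · exact ⟨CentreSeq.nil Y, trivial, trivial, hreg⟩
  haveI hne : Nonempty Y := by
    by_contra h
    exact hreg fun y => (h ⟨y⟩).elim
  obtain ⟨s, hperm, hsOver, hmono, hME2⟩ := exists_sigmaMaxSeq_overField hν g hdim hreg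
  haveI : IsProper s.comp := CentreSeq.isProper_comp s
  haveI : IsReduced s.top := SigmaMaxModifications.Sketch.isReduced_top s
  have hdim' : topologicalKrullDim s.top ≤ (d : WithBot ℕ∞) := CentreSeq.topologicalKrullDim_top_le s hdim
  have hR : HSStep d s.top Y := ⟨inferInstance, hexc, hne, hdim, s.comp, hmono, hME2⟩
  obtain ⟨t, htperm, htOver, htreg⟩ := ih s.top hR (s.comp ≫ g) hdim'
  refine ⟨s.append t, (allPermissible_append_iff s t).mpr ⟨hperm, htperm⟩,
    CentreSeq.centresOver_compl_regularLocus_append s hsOver t htOver, ?_⟩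
  rw [CentreSeq.top_append]
  exact htreg

end CampaignW42

end Summit.ResolutionOfSingularities.ResolutionOfSingularities.Theorems

end
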